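import Mathlib
import Literature.NumberTheory.Transcendental.LinEDS
import Literature.NumberTheory.Transcendental.LinEDSCode
import Literature.NumberTheory.Transcendental.MZVShuffleRegularisation
import Summits.KontsevichZagierPeriods.KontsevichZagierPeriods.Theorems.FurushoPentagonKernelModuloPeriodConjectureRowBitsParity
import Summits.KontsevichZagierPeriods.KontsevichZagierPeriods.Theorems.FurushoPentagonKernelModuloPeriodConjectureLeafOfCheck
import HarnessLib

/-!
# `KernelModuloPeriodConjecture`, line `Sketch`: the leaf from an odd determinant (any indexing)

Crux `FurushoPentagon.KernelModuloPeriodConjecture` (stmt-KontsevichZagierPeriods-15058), line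
`Sketch`. The second half of the master soundness theorem of the GF(2) rank engine
(`stub_leaf_of_check`, `…LeafOfCheck.lean`), isolated and generalised to an ARBITRARY finite
indexing of the square relation matrix (registered helper stub `stub_leaf_of_oddDet`): if valid row
names `ν i` and columns `col j ∈ cols k` (hitting every column) are indexed by a finite type `ι` and
the integer matrix `entry k (ν i) (col j)` has ODD determinant, then every admissible index of
weight `k` has one Hoffman expansion valid at every group-like pentagon solution. This is what the
block certificates of `LinEDS` §9 (block lower-triangular by depth, several kernel runs per
weight) feed, with `ι` a sigma type over the blocks. Ingredients: E5 `stub_eval_rowZ_divFold`, E8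
`stub_cols_spec`, E9 `stub_rowBits_parity` / `stub_rowZ_support_shape`, and linear algebra over `ℚ`.

References: K. Ihara, M. Kaneko, D. Zagier, Compos. Math. 142 (2006) §2 [IharaKanekoZagier2006].
-/

namespace Summit.KontsevichZagierPeriods.FurushoPentagon.KernelModuloPeriodConjecture

open Literature.NumberTheory.Transcendental
open Literature.NumberTheory.Transcendental.LinEDS

/-- Odd determinant ⇒ every standard basis row vector is a rational combination of the rows (any
finite index type). [folklore] -/
theorem oddDetE11_solve {ι : Type} [Fintype ι] [DecidableEq ι] (A : Matrix ι ι ℤ) (hA : Odd A.det)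
    (j₀ : ι) : ∃ l : ι → ℚ, ∀ j, ∑ i, l i * (A i j : ℚ) = if j = j₀ then 1 else 0 := by
  have hdet : IsUnit (A.map fun x : ℤ => (x : ℚ)).det := by
    rw [isUnit_iff_ne_zero, ← Int.cast_det, Int.cast_ne_zero]
    intro h0
    rw [h0] at hA
    exact absurd (Int.odd_iff.1 hA) (by decide)
  refine ⟨(A.map fun x : ℤ => (x : ℚ))⁻¹ j₀, fun j => ?_⟩
  have h := congrFun (congrFun (Matrix.nonsing_inv_mul _ hdet) j₀) j
  rw [Matrix.mul_apply, Matrix.one_apply] at h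
  simp only [Matrix.map_apply] at h
  rw [h]
  exact if_congr eq_comm rfl rfl

/-- Odd determinant ⇒ the column labels are distinct. [folklore] -/
theorem oddDetE11_col_injective {ι : Type} [Fintype ι] [DecidableEq ι] {k : ℕ}
    (ν : ι → List ℕ × List ℕ) (col : ι → ℕ)
    (hA : Odd (Matrix.of fun i j => LinEDS.entry k (ν i) (col j)).det) : Function.Injective col := by
  intro j j' h
  by_contra hne
  have h0 : (Matrix.of fun i j => LinEDS.entry k (ν i) (col j)).det = 0 :=
    Matrix.det_zero_of_column_eq hne (fun i => by rw [Matrix.of_apply, Matrix.of_apply, h])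
  rw [h0] at hA
  exact absurd (Int.odd_iff.1 hA) (by decide)

/-- **The leaf from an odd determinant** (registered helper stub `stub_leaf_of_oddDet`, lead c5;
crux stmt-KontsevichZagierPeriods-15058, line `Sketch`): valid row names and columns of weight `k`
indexed by any finite type, columns hitting every column of the engine, odd determinant of the
integer relation matrix ⇒ the weight-`k` slice of the algebraic leaf.
[cite: IharaKanekoZagier2006, Conjecture 1] -/
theorem stub_leaf_of_oddDet :
    ∀ (k : ℕ) (ι : Type) [Fintype ι] [DecidableEq ι] (ν : ι → List ℕ × List ℕ) (col : ι → ℕ),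
      2 ≤ k → (∀ i, LinEDS.validName k (ν i) = true) → (∀ j, col j ∈ LinEDS.cols k) →
      (∀ c ∈ LinEDS.cols k, ∃ j, col j = c) →
      Odd (Matrix.of fun i j => LinEDS.entry k (ν i) (col j)).det →
      ∀ s : List ℕ, MZV.IsAdmissible s → MZV.weight s = k →
        ∃ b : List ℕ →₀ ℚ, (∀ t ∈ b.support, MZV.IsHoffman t ∧ MZV.weight t = MZV.weight s) ∧ ∀ (R : Type) [CommRing R] [Algebra ℚ R] [IsReduced R] (φ : NCSeries Bool R), NCSeries.IsGroupLike φ → NCSeries.DrinfeldPentagon φ → φ (MZV.binaryWord s) = b.sum (fun t q => q • φ (MZV.binaryWord t)) := by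
  classical
  intro k ι _ _ ν col hk2 hvalid hcolmem hcolsurj hdet s hs hw
  by_cases hH : MZV.IsHoffman s
  · exact leafLowWeight_of_isHoffman hH
  have hs0 : s ≠ [] := by rintro rfl; exact hH fun i hi => by simp at hi
  obtain ⟨a, s', rfl⟩ := List.exists_cons_of_ne_nil hs0
  obtain ⟨hpw, hcols, hhof, -⟩ := stub_cols_spec k hk2
  -- the column of `s`
  set c₀ := LinEDS.code (MZV.binaryWord (a :: s')) with hc₀
  have hwlen : (MZV.binaryWord (a :: s')).length = k := by rw [MZV.length_binaryWord hs.1, hw]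
  obtain ⟨hc₀lt, hc₀odd⟩ := masterE10_code_binaryWord hs hs0
  rw [hw] at hc₀lt
  have hwc₀ : LinEDS.wordOfCode k c₀ = MZV.binaryWord (a :: s') := by rw [hc₀, ← hwlen, wordOfCode_code]
  have hc₀col : c₀ ∈ LinEDS.cols k := by
    refine (hcols c₀).mpr ⟨hc₀lt, hc₀odd, ?_⟩
    rintro ⟨t, ht, htw⟩
    rw [hwc₀] at htw
    have hpos : ∀ i ∈ t, 1 ≤ i := fun i hi => by rcases ht i hi with rfl | rfl <;> omega
    have := congrArg MZV.ofBinaryWord htw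
    rw [MZV.ofBinaryWord_binaryWord hpos, MZV.ofBinaryWord_binaryWord hs.1] at this
    subst this
    exact hH ht
  set A : Matrix ι ι ℤ := Matrix.of fun i j => LinEDS.entry k (ν i) (col j) with hA
  have hinj := oddDetE11_col_injective ν col hdet
  obtain ⟨j₀, hcolj₀⟩ := hcolsurj c₀ hc₀col
  obtain ⟨l, hl⟩ := oddDetE11_solve A hdet j₀
  -- the folded integer rows and their coefficients
  let g : ι → (List Bool →₀ ℤ) := fun i => LinEDS.divFold (LinEDS.rowZ (ν i))
  let coef : List Bool → ℚ := fun w => ∑ i, l i * (g i w : ℚ)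
  have hcoef_col : ∀ j, coef (LinEDS.wordOfCode k (col j)) = if j = j₀ then 1 else 0 := fun j => by
    rw [← hl j]; rfl
  have hcoef_cols : ∀ c ∈ LinEDS.cols k, coef (LinEDS.wordOfCode k c) = if c = c₀ then 1 else 0 := by
    intro c hc
    obtain ⟨j, rfl⟩ := hcolsurj c hc
    rw [hcoef_col]
    by_cases hj : j = j₀
    · subst hj; simp [hcolj₀]
    · rw [if_neg hj, if_neg]
      intro h; exact hj (hinj (h.trans hcolj₀.symm))
  -- the answer
  let T : Finset (List ℕ) := (LinEDS.hofLists k).toFinset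
  refine ⟨∑ t ∈ T, Finsupp.single t (-coef (MZV.binaryWord t)), fun t ht => ?_,
    fun R _ _ _ φ hg h5 => ?_⟩
  · -- support
    have ht' : t ∈ T := by
      by_contra hnot
      rw [Finsupp.mem_support_iff, Finsupp.finsetSum_apply] at ht
      exact ht (Finset.sum_eq_zero fun t' ht'' => Finsupp.single_eq_of_ne fun h => hnot (h ▸ ht''))
    obtain ⟨hH', hwt⟩ := (hhof t).mp (List.mem_toFinset.mp ht')
    exact ⟨hH', by rw [hwt, hw]⟩
  · -- the identity at a pentagon solution
    have h1 : φ [true] = 0 := h5.apply_letter_eq_zero_of_isGroupLike hg true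
    -- every folded row evaluates to zero
    have hev : ∀ i, LinEDS.evalZ φ (g i) = 0 := fun i => by
      show LinEDS.evalZ φ (LinEDS.divFold (LinEDS.rowZ (ν i))) = 0
      rw [stub_eval_rowZ_divFold.2 R φ hg h1 _ (fun w hw =>
        (stub_rowZ_support_shape k _ (hvalid i) w hw).2.1)]
      exact stub_eval_rowZ_divFold.1 R φ hg h5 k _ (hvalid i)
    -- the common finite set of words: column words and Hoffman words
    let Wc : Finset (List Bool) := ((LinEDS.cols k).map (LinEDS.wordOfCode k)).toFinset
    let Wh : Finset (List Bool) := T.image MZV.binaryWord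
    have hsupp : ∀ i, (g i).support ⊆ Wc ∪ Wh := by
      intro i w hw
      obtain ⟨hwl, hwh, hwlast⟩ := (stub_rowBits_parity k _ (hvalid i)).2.2 w hw
      have hne : w ≠ [] := by rintro rfl; simp at hwh
      -- admissible code
      have hcodelt : LinEDS.code w < 2 ^ (k - 1) := by
        rw [List.eq_cons_of_mem_head? hwh, code_cons]
        simp only [Bool.toNat_false, zero_mul, zero_add]
        have := code_lt w.tail
        rwa [List.length_tail, hwl] at this
      have hcodeodd : LinEDS.code w % 2 = 1 := by
        have h0 : (LinEDS.code w).testBit 0 = true := by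
          rw [testBit_code]
          obtain ⟨w', hw'⟩ := List.getLast?_eq_some_iff.mp hwlast
          rw [hw']; simp
        simpa using h0
      have hww : LinEDS.wordOfCode k (LinEDS.code w) = w := by rw [← hwl, wordOfCode_code]
      by_cases hcw : LinEDS.code w ∈ LinEDS.cols k
      · exact Finset.mem_union_left _ (List.mem_toFinset.mpr
          (List.mem_map.mpr ⟨_, hcw, hww⟩))
      · have : ∃ t, MZV.IsHoffman t ∧ MZV.binaryWord t = LinEDS.wordOfCode k (LinEDS.code w) := by
          by_contra hno
          exact hcw ((hcols _).mpr ⟨hcodelt, hcodeodd, hno⟩)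
        obtain ⟨t, ht, htw⟩ := this
        rw [hww] at htw
        refine Finset.mem_union_right _ (Finset.mem_image.mpr ⟨t, List.mem_toFinset.mpr ?_, htw⟩)
        refine (hhof t).mpr ⟨ht, ?_⟩
        have hpos : ∀ i ∈ t, 1 ≤ i := fun i hi => by rcases ht i hi with rfl | rfl <;> omega
        rw [← MZV.length_binaryWord hpos, htw, hwl]
    have hdisj : Disjoint Wc Wh := by
      rw [Finset.disjoint_left]
      intro w hwc hwh
      obtain ⟨c, hc, rfl⟩ := List.mem_map.mp (List.mem_toFinset.mp hwc)
      obtain ⟨t, ht, htw⟩ := Finset.mem_image.mp hwh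
      exact ((hcols c).mp hc).2.2 ⟨t, ((hhof t).mp (List.mem_toFinset.mp ht)).1, htw⟩
    -- evaluation of each folded row as a sum over the common set, with rational scalars
    have hevsum : ∀ i, LinEDS.evalZ φ (g i) = ∑ w ∈ Wc ∪ Wh, ((g i w : ℤ) : ℚ) • φ w := by
      intro i
      unfold LinEDS.evalZ
      refine (Finsupp.sum_of_support_subset (g i) (hsupp i) (fun w n => n • φ w)
        (fun w _ => zero_smul ℤ (φ w))).trans ?_
      exact Finset.sum_congr rfl fun w _ => (Int.cast_smul_eq_zsmul ℚ _ _).symm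
    -- combine with the rational coefficients `l`
    have hzero : ∑ w ∈ Wc ∪ Wh, coef w • φ w = 0 := by
      have : ∑ i, l i • LinEDS.evalZ φ (g i) = 0 := Finset.sum_eq_zero fun i _ => by
        rw [hev i, smul_zero]
      rw [← this]
      simp_rw [hevsum, Finset.smul_sum, smul_smul]
      rw [Finset.sum_comm]
      exact Finset.sum_congr rfl fun w _ => by rw [← Finset.sum_smul]
    rw [Finset.sum_union hdisj] at hzero
    -- the column part is `φ (bw s)`
    have hcolpart : ∑ w ∈ Wc, coef w • φ w = φ (MZV.binaryWord (a :: s')) := by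
      have hnd : (LinEDS.cols k).Nodup := hpw.imp fun {x y} (h : x < y) => ne_of_lt h
      have hcodeinj : ∀ x ∈ LinEDS.cols k, ∀ y ∈ LinEDS.cols k,
          LinEDS.wordOfCode k x = LinEDS.wordOfCode k y → x = y := by
        intro x hx y hy hxy
        have hx' := ((hcols x).mp hx).1
        have hy' := ((hcols y).mp hy).1
        have := congrArg LinEDS.code hxy
        rwa [code_wordOfCode (lt_of_lt_of_le hx' (Nat.pow_le_pow_right (by norm_num) (by omega))),
          code_wordOfCode (lt_of_lt_of_le hy' (Nat.pow_le_pow_right (by norm_num) (by omega)))] at this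
      have hWc : Wc = (LinEDS.cols k).toFinset.image (LinEDS.wordOfCode k) := by
        ext w; simp [Wc, List.mem_toFinset]
      rw [hWc, Finset.sum_image (fun x hx y hy h => hcodeinj x (List.mem_toFinset.mp hx) y
        (List.mem_toFinset.mp hy) h)]
      rw [Finset.sum_congr rfl (g := fun c => if c = c₀ then φ (LinEDS.wordOfCode k c₀) else 0)
        (fun c hc => by
          rw [hcoef_cols c (List.mem_toFinset.mp hc)]
          by_cases h : c = c₀
          · subst h; simp
          · simp [h]),
        Finset.sum_ite_eq', if_pos (List.mem_toFinset.mpr hc₀col), hwc₀]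
    -- the Hoffman part is the `b`-sum
    have hhofpart : ∑ w ∈ Wh, coef w • φ w = ∑ t ∈ T, coef (MZV.binaryWord t) • φ (MZV.binaryWord t) := by
      refine Finset.sum_image fun t ht t' ht' h => ?_
      have hpos : ∀ i ∈ t, 1 ≤ i := fun i hi => by
        rcases ((hhof t).mp (List.mem_toFinset.mp ht)).1 i hi with rfl | rfl <;> omega
      have hpos' : ∀ i ∈ t', 1 ≤ i := fun i hi => by
        rcases ((hhof t').mp (List.mem_toFinset.mp ht')).1 i hi with rfl | rfl <;> omega
      have := congrArg MZV.ofBinaryWord h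
      rwa [MZV.ofBinaryWord_binaryWord hpos, MZV.ofBinaryWord_binaryWord hpos'] at this
    rw [hcolpart, hhofpart] at hzero
    rw [masterE10_sum_finset_single T _ (fun t q => q • φ (MZV.binaryWord t)) (fun t => zero_smul ℚ _)
      (fun t a b => add_smul a b _)]
    simp_rw [neg_smul, Finset.sum_neg_distrib]
    rw [eq_neg_iff_add_eq_zero, hzero]

end Summit.KontsevichZagierPeriods.FurushoPentagon.KernelModuloPeriodConjecture
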